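import Summits.Parity.GeneralizedHardyLittlewood.Theorems.LiouvilleMADEngineToGHLPairsReach
import Summits.Parity.GeneralizedHardyLittlewood.Theorems.LeeYangFibresPrimeCellsRelativeHardyLittlewoodDictionary
import HarnessLib

/-!
# `EngineToGHL` (stmt-Parity-14995), line `tuple_ladder` (cycle 2), stub `stub_reachSingular`

Crux `Summit.Parity.GeneralizedHardyLittlewood.Theses.LiouvilleMAD.EngineToGHL`, line `tuple_ladder`
(cycle 2: the reach of the tuples conjecture inside `DimOne`), stub `stub_reachSingular`: for a
UNIT-SLOPE system `ψᵢ(n) = n + bᵢ` on `ℤ` (`d = 1`) with DISTINCT shifts `bᵢ`, Green–Tao's singular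
product `∏_p β_p` (`singularProduct`, the ordered `limUnder` of `∏_{p ≤ x} β_p`) IS the
Hardy–Littlewood singular series `𝔖(H_c)` (`singularSeries`, the ordered `limUnder` of
`∏_{p ≤ x} (1 - ν(p)/p)(1 - 1/p)^{-#H_c}`) of the shift set translated by ANY `c`,
`H_c = {bᵢ - c}`.  No convergence is needed: factor by factor
`β_p = p⁻¹ (p/(p-1))^t (p - #{bᵢ mod p}) = (1 - ν_{H_c}(p)/p)(1 - 1/p)^{-t}`
(`localFactor_unitSlope_eq_singularSeriesFactor`, from the tree's
`Cruxes.PrimeCellsRelative.Sketch.goodCount_shift_add`, `localFactor_prime`; `ν` and `#` are translation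
invariant, `#H_c = t` by injectivity), so the ordered partial products agree term by term
(`singularProduct_unitSlope_eq_singularSeries`), exactly as in the tree's
`Cruxes.PrimeCellsRelative.Sketch.singularProduct_shift_eq_singularSeries` for the enumerated
shift system of a tuple; the given system IS the shift system of `b = (ψᵢ(0))ᵢ` by `AffLinForm.ext`.

References: B. Green, T. Tao, *Linear equations in primes*, Ann. of Math. 171 (2010), Example 1,
(1.6)–(1.7) [GreenTao2010]; G. H. Hardy, J. E. Littlewood, Acta Math. 44 (1923), Conjecture B
[HardyLittlewood1923].

[folklore]
-/

noncomputable section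

namespace Summit.Parity.GeneralizedHardyLittlewood.Theorems.EngineToGHL.TupleLadder

open scoped BigOperators Topology
open Filter Finset Literature.NumberTheory.Sieve
open Summit.Parity.GeneralizedHardyLittlewood.Cruxes.PrimeCellsRelative.Sketch (goodCount_shift_add)

variable {t : ℕ}

/-- A unit-slope system `ψᵢ(n) = n + bᵢ` on `ℤ` IS the shift system of its constants
`bᵢ = ψᵢ(0)`. [folklore] -/
theorem unitSlope_eq_shift (Ψ : Fin t → AffLinForm 1) (hcoeff : ∀ i j, (Ψ i).coeff j = 1) :
    Ψ = fun i => (⟨fun _ => (1 : ℤ), (Ψ i).const⟩ : AffLinForm 1) :=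
  funext fun i => AffLinForm.ext (funext fun j => hcoeff i j) rfl

/-- Translation invariance of the residue count: `#{(bᵢ - c) mod p} = #{bᵢ mod p}`
(`x ↦ x - c` is a bijection of `ℤ/p`). [folklore] -/
theorem card_image_intCast_sub (b : Fin t → ℤ) (c : ℤ) (p : ℕ) :
    #(univ.image fun i => ((b i - c : ℤ) : ZMod p)) = #(univ.image fun i => (b i : ZMod p)) := by
  have h : (univ.image fun i => ((b i - c : ℤ) : ZMod p)) =
      (univ.image fun i => (b i : ZMod p)).image fun x => x - (c : ZMod p) := by
    rw [Finset.image_image]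
    congr 1
    funext i
    simp [Int.cast_sub]
  rw [h, Finset.card_image_of_injective _ sub_left_injective]

/-- The residue count of the translated shift set is that of the shifts:
`ν_{H_c}(p) = #{bᵢ mod p}` for `H_c = {bᵢ - c}`. [folklore] -/
theorem tupleResidueCount_image_sub (b : Fin t → ℤ) (c : ℤ) (p : ℕ) :
    tupleResidueCount (univ.image fun i => b i - c) p = #(univ.image fun i => (b i : ZMod p)) := by
  unfold tupleResidueCount
  rw [Finset.image_image]
  exact card_image_intCast_sub b c p

/-- For distinct shifts the translated shift set has `t` elements: `#{bᵢ - c} = t`. [folklore] -/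
theorem card_image_sub_eq (b : Fin t → ℤ) (hb : Function.Injective b) (c : ℤ) :
    #(univ.image fun i => b i - c) = t := by
  rw [Finset.card_image_of_injective _ fun i j h => hb (sub_left_injective h), Finset.card_univ,
    Fintype.card_fin]

/-- **Factor by factor, Green–Tao's local factor of the shift system `(n + bᵢ)ᵢ` with distinct
shifts is the Hardy–Littlewood Euler factor of `𝔖({bᵢ - c})`** for every translate `c`:
`β_p = p⁻¹ (p/(p-1))^t (p - #{bᵢ mod p}) = (1 - ν(p)/p)(1 - 1/p)^{-t}`.
[cite: GreenTao2010, Example 1 and (1.6)] -/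
theorem localFactor_unitSlope_eq_singularSeriesFactor (b : Fin t → ℤ) (hb : Function.Injective b)
    (c : ℤ) {p : ℕ} (hp : p.Prime) :
    localFactor (fun i => (⟨fun _ => (1 : ℤ), b i⟩ : AffLinForm 1)) p =
      singularSeriesFactor (univ.image fun i => b i - c) p := by
  haveI := Fact.mk hp
  have hp1 : (1 : ℝ) < p := by exact_mod_cast hp.one_lt
  have hp0 : (p : ℝ) ≠ 0 := by positivity
  have hpm : (p : ℝ) - 1 ≠ 0 := by linarith
  have hg := goodCount_shift_add b p
  have hg' : (goodCount (fun i => (⟨fun _ => (1 : ℤ), b i⟩ : AffLinForm 1)) p : ℝ) =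
      p - tupleResidueCount (univ.image fun i => b i - c) p := by
    rw [tupleResidueCount_image_sub, eq_sub_iff_add_eq]
    exact_mod_cast hg
  rw [localFactor_prime, hg', singularSeriesFactor, pow_one, card_image_sub_eq b hb c]
  have h1 : (1 - 1 / (p : ℝ))⁻¹ = p / (p - 1) := by
    field_simp
  rw [h1]
  field_simp

/-- **`∏_p β_p = 𝔖({bᵢ - c})` for the shift system `(n + bᵢ)ᵢ` with distinct shifts and any
translate `c`**: the ordered partial products agree term by term, hence so do their `limUnder`s
(no convergence needed). [cite: GreenTao2010, Example 1 and (1.7)] -/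
theorem singularProduct_unitSlope_eq_singularSeries (b : Fin t → ℤ) (hb : Function.Injective b)
    (c : ℤ) :
    singularProduct (fun i => (⟨fun _ => (1 : ℤ), b i⟩ : AffLinForm 1)) =
      singularSeries (univ.image fun i => b i - c) := by
  unfold singularSeries singularProduct
  congr 1
  funext x
  unfold singularSeriesPartial singularProductPartial
  exact Finset.prod_congr rfl fun p hp =>
    localFactor_unitSlope_eq_singularSeriesFactor b hb c (Nat.mem_primesLE.mp hp).2

/-- **stub_reachSingular.** For a unit-slope system `ψᵢ(n) = n + bᵢ` on `ℤ` with distinct shifts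
`bᵢ`, Green–Tao's singular product `∏_p β_p` is the Hardy–Littlewood singular series of the shift
set translated by any `c`: `∏_p β_p = 𝔖({bᵢ - c})` (the system IS the shift system of `b` by
`AffLinForm.ext`; then `singularProduct_unitSlope_eq_singularSeries`).
[cite: GreenTao2010, Example 1 and (1.6)–(1.7)] -/
theorem stub_reachSingular : ∀ (t : ℕ) (Ψ : Fin t → Literature.NumberTheory.Sieve.AffLinForm 1), (∀ i j, (Ψ i).coeff j = 1) → Function.Injective (fun i => (Ψ i).const) → ∀ c : ℤ, Literature.NumberTheory.Sieve.singularProduct Ψ = Literature.NumberTheory.Sieve.singularSeries (Finset.univ.image (fun i => (Ψ i).const - c)) := by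
  intro t Ψ hcoeff hinj c
  calc singularProduct Ψ
      = singularProduct (fun i => (⟨fun _ => (1 : ℤ), (Ψ i).const⟩ : AffLinForm 1)) :=
        congrArg singularProduct (unitSlope_eq_shift Ψ hcoeff)
    _ = singularSeries (univ.image fun i => (Ψ i).const - c) :=
        singularProduct_unitSlope_eq_singularSeries (fun i => (Ψ i).const) hinj c

end Summit.Parity.GeneralizedHardyLittlewood.Theorems.EngineToGHL.TupleLadder

end
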